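import Summits.HodgeConjecture.CorCM.MumfordTateRankProductsOfCurves
import Summits.HodgeConjecture.CorCM.MumfordTateRankSurfaceTimesTwoCurves
import Summits.HodgeConjecture.CorCM.MumfordTateRankSimpleThreefolds
import Summits.HodgeConjecture.CorCM.MumfordTateRankTimesLowGeneric
import Summits.HodgeConjecture.CorCM.MumfordTateRankTimesRealMultiplicationCells
import HarnessLib

/-!
# A factor times any number of elliptic curves: `t(A × ⨁ E) = t(A) + 3a` for non-CM curves with `Hom(A, E_j) = 0` (any multiplicities), and
# `t(T × E₀ × ⋯ × E_m) = t(T) + 3a + b` for a simple THREEFOLD with totally real `End⁰T` (`ℚ` or a cubic field) — Moonen–Zarhin (3.4), (3.8), (5.2)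

COR-CM (cell `pub-hodgecm2`, seat `b27` gen 49, count-neutral Mumford–Tate-rank ladder; theorems only, no definition, no named fact;
UNCONDITIONAL — nothing here uses or asserts HC_CM).  Notation `t(X) = dim MT(H¹X)`; `a` (`b`) = number of isogeny classes of the non-CM (CM)
curves among `E₀, …, E_m`.

* §1 `exists_mtRank_hodge_one_eq_add_of_isIsogenous_prod_biproduct_nonCM_curves'` — Moonen–Zarhin Prop. (3.8) WITH REPETITIONS: for ANY `A` of positive
  dimension and non-CM curves `E_j` with `Hom(A, E_j) = 0`, `t(A × ⨁ E) = t(A) + 3a` (peel: a curve isogenous to a later one is a duplicate factor,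
  `CorCM/MumfordTateRankDuplicateFactor`; a new one adds `3`, Lemma (3.4)); e.g. `A` simple of dimension `≥ 2`
  (`exists_mtRank_hodge_one_eq_add_of_isIsogenous_isSimple_prod_biproduct_nonCM_curves`).
* §2 simple threefold `T` with `dim_ℚ End⁰T ∈ {1, 3}` (`End⁰T = ℚ`, `t(T) = 22`; a totally real cubic field, `t(T) = 10`) and ARBITRARY curves:
  `Hom(⨁ E, T) = 0` and the gen-47 engines give `t(X) + 1 = t(T) + t(⨁ E)`, so **`t(X) = t(T) + 3a + b`**
  (`exists_mtRank_hodge_one_eq_of_isIsogenous_threefold_totallyRealEnd_prod_biproduct_curves`); fivefold cells `T × E × E'`: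
  `{23, 24, 25, 26, 28}` (`End⁰T = ℚ`) and `{11, 12, 13, 14, 16}` (cubic).
(The simple threefolds with `dim_ℚ End⁰T ∈ {2, 6}` — type IV and CM — times CM curves depend on field embeddings: `CorCM/MumfordTateRankTimesCMCurveSameField`,
`CorCM/MumfordTateRankCMCurveTimesCMThreefold`; not treated here beyond §1.)

## References
* [MoonenZarhin1999LowDim] B. Moonen, Yu. G. Zarhin, *Hodge classes on abelian varieties of low dimension*, Math. Ann. 315 (1999), §2 (2.3), §3 Lemma (3.4),
  Prop. (3.8), §5 (5.2) [corpus: paper:arxiv-math_9901113 pp. 5–7, 10]. [cite: MoonenZarhin1999LowDim, §3 (3.4) and (3.8)]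
* [Gordon1999HodgeAVSurvey] B. B. Gordon, *A survey of the Hodge conjecture for abelian varieties*, §3 Theorem (Imai), 7.6.1. [cite: Gordon1999HodgeAVSurvey, §3 Theorem (Imai) and 7.6.1]
* [MumfordAV1970] D. Mumford, *Abelian Varieties* (1970), §19 Thm. 1, Cor. 2. [cite: MumfordAV1970, §19 Cor. 2 of Thm. 1]
-/

noncomputable section

open CategoryTheory CategoryTheory.Limits Module
open scoped BigOperators

namespace Summit.HodgeConjecture.CorCM

open Literature.AlgebraicGeometry.Motives
open Literature.AlgebraicGeometry.Motives.AbelianVariety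
open Literature.AlgebraicGeometry.Motives.HodgeStructure
open Literature.AlgebraicGeometry.HodgeTheory
open Literature.AlgebraicGeometry.Milne1999 (IsOfCMType isOfCMType_iff_of_isIsogenous hom_eq_zero_of_isSimple_of_not_isIsogenous)

variable [HodgeTensorFacts.{0, 0}] {X : AbelianVariety ℂ} {n : ℕ}

/-! ## §1 `A × (non-CM curves with repetitions)`: `t = t(A) + 3a` -/

/-- **Moonen–Zarhin Prop. (3.8) with repetitions: `t(A × E₀ × ⋯ × E_m) = t(A) + 3a`** for ANY abelian variety `A` of positive dimension and non-CM
elliptic curves `E_j` with `Hom(A, E_j) = 0`, `a` the number of isogeny classes among the `E_j` (`1 ≤ a ≤ m + 1`).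
[cite: MoonenZarhin1999LowDim, §3 (3.4) and (3.8)] [cite: Gordon1999HodgeAVSurvey, §3 Theorem (Imai) and 7.6.1] -/
theorem exists_mtRank_hodge_one_eq_add_of_isIsogenous_prod_biproduct_nonCM_curves' : ∀ {m : ℕ} {X : AbelianVariety ℂ} {n : ℕ}
    (hX : IsSmoothProjective n X.X) {A : AbelianVariety ℂ} {k : ℕ} (hA : IsSmoothProjective k A.X) (_hA0 : 0 < A.dim)
    {E : Fin (m + 1) → AbelianVariety ℂ}, (∀ j, (E j).dim = 1) → (∀ j, ¬ IsOfCMType (E j)) → (∀ j, ∀ u : A ⟶ E j, u = 0) →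
    IsIsogenous X (A.prod (⨁ E)) →
    haveI := BettiUniverse.finite hX 1
    haveI := BettiUniverse.finite hA 1
    ∃ a : ℕ, 1 ≤ a ∧ a ≤ m + 1 ∧
      (BettiUniverse.hodge exists_isReal_hodgeModel_holds hX 1).mtRank = (BettiUniverse.hodge exists_isReal_hodgeModel_holds hA 1).mtRank + 3 * a
  | 0, X, n, hX, A, k, hA, hA0, E, hE1, hcm, hAE, hXP => by
    classical
    obtain ⟨g, hg⟩ := isIsogenous_biproduct_of_forall_eq E 0 (fun j => Fin.ext (by have := j.2; omega))
    have hXQ : IsIsogenous X ((E 0).prod A) :=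
      (hXP.trans ⟨prodMap (𝟙 A) g, isIsogeny_prodMap (isIsogeny_id _) hg⟩).trans (Literature.AlgebraicGeometry.HodgeTheory.isIsogenous_prod_comm A (E 0))
    exact ⟨1, le_rfl, le_rfl, mtRank_hodge_one_eq_add_three_of_isIsogenous_nonCMCurve_prod hX hA hA0 (hE1 0) (hcm 0) (hAE 0) hXQ⟩
  | m + 1, X, n, hX, A, k, hA, hA0, E, hE1, hcm, hAE, hXP => by
    classical
    haveI := BettiUniverse.finite hX 1
    haveI := BettiUniverse.finite hA 1
    -- `⨁ E ∼ E 0 × ⨁ (E ∘ succ)`, `Y := A × ⨁ (E ∘ succ)`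
    obtain ⟨h, g, hhg, hgh⟩ := AndreRiemann.biproduct_succ_split E
    have hh : IsIsogeny h := isIsogeny_of_comp_eq_of_comp_eq (isIsogeny_id _) (isIsogeny_id _) hgh hhg
    have hY : IsSmoothProjective (A.prod (⨁ (E ∘ Fin.succ))).dim (A.prod (⨁ (E ∘ Fin.succ))).X := AbelianVariety.isSmoothProjective_holds
    haveI := BettiUniverse.finite hY 1
    have hXP' : IsIsogenous X ((E 0).prod (A.prod (⨁ (E ∘ Fin.succ)))) :=
      ((hXP.trans ((IsIsogenous.refl A).prod ⟨h, hh⟩)).trans (Summit.HodgeConjecture.CorCM.isIsogenous_prod_assoc A (E 0) _)).trans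
        (((Literature.AlgebraicGeometry.HodgeTheory.isIsogenous_prod_comm A (E 0)).prod (IsIsogenous.refl _)).trans
          (Literature.AlgebraicGeometry.HodgeTheory.isIsogenous_prod_assoc (E 0) A _))
    obtain ⟨a, ha1, ham, ih⟩ := exists_mtRank_hodge_one_eq_add_of_isIsogenous_prod_biproduct_nonCM_curves' hY hA hA0 (E := E ∘ Fin.succ)
      (fun j => hE1 j.succ) (fun j => hcm j.succ) (fun j => hAE j.succ) (IsIsogenous.refl _)
    by_cases hdup : ∃ j : Fin (m + 1), IsIsogenous (E 0) (E j.succ)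
    · -- duplicate factor: `X ∼ ((A × ⨁_{l ≠ j} E_{l+1}) × E_{j+1}) × E 0` with `E 0 ∼ E_{j+1}`
      obtain ⟨j, ⟨g₀, hg₀⟩⟩ := hdup
      obtain ⟨u, hu⟩ := isIsogenous_biproduct_prod_erase (E ∘ Fin.succ) j
      have hYQ : IsIsogenous (A.prod (⨁ (E ∘ Fin.succ))) ((A.prod (⨁ fun l : {l // l ≠ j} => (E ∘ Fin.succ) l.1)).prod ((E ∘ Fin.succ) j)) :=
        ((IsIsogenous.refl A).prod ⟨u, hu⟩).trans (Summit.HodgeConjecture.CorCM.isIsogenous_prod_assoc A _ _)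
      obtain ⟨v, hv⟩ := hYQ
      have hXQ : IsIsogenous X (((A.prod (⨁ fun l : {l // l ≠ j} => (E ∘ Fin.succ) l.1)).prod ((E ∘ Fin.succ) j)).prod ((E ∘ Fin.succ) j)) :=
        (hXP'.trans (Literature.AlgebraicGeometry.HodgeTheory.isIsogenous_prod_comm (E 0) _)).trans ⟨prodMap v g₀, isIsogeny_prodMap hv hg₀⟩
      have h0 : 0 < ((A.prod (⨁ fun l : {l // l ≠ j} => (E ∘ Fin.succ) l.1)).prod ((E ∘ Fin.succ) j)).dim := by
        rw [dim_prod, dim_prod]; omega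
      have hdq := mtRank_hodge_one_eq_of_isIsogenous_prod_prod_self hX hY h0 hXQ ⟨v, hv⟩
      exact ⟨a, ha1, by omega, hdq.trans ih⟩
    · -- a new curve: `Hom(Y, E 0) = 0`, `t(X) = t(Y) + 3`
      push Not at hdup
      have hY0 : 0 < (A.prod (⨁ (E ∘ Fin.succ))).dim := by rw [dim_prod]; omega
      have hYE : ∀ w : A.prod (⨁ (E ∘ Fin.succ)) ⟶ E 0, w = 0 :=
        forall_hom_prod_eq_zero (hAE 0) fun w => biproduct.hom_ext' _ _ fun j => by
          rw [comp_zero]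
          exact hom_eq_zero_of_isSimple_of_not_isIsogenous (isSimple_of_dim_le_one (hE1 j.succ).le) (isSimple_of_dim_le_one (hE1 0).le)
            (fun hiso => hdup j hiso.symm') _
      have h3 := mtRank_hodge_one_eq_add_three_of_isIsogenous_nonCMCurve_prod hX hY hY0 (hE1 0) (hcm 0) hYE hXP'
      exact ⟨a + 1, by omega, by omega, by rw [h3, ih]; ring⟩

/-- **A SIMPLE abelian variety of dimension `≥ 2` times non-CM curves: `t(A × E₀ × ⋯ × E_m) = t(A) + 3a`** (`Hom(A, E_j) = 0` automatically).
[cite: MoonenZarhin1999LowDim, §3 (3.4) and (3.8)] [cite: MumfordAV1970, §19 Cor. 2 of Thm. 1] -/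
theorem exists_mtRank_hodge_one_eq_add_of_isIsogenous_isSimple_prod_biproduct_nonCM_curves {m : ℕ} (hX : IsSmoothProjective n X.X)
    {A : AbelianVariety ℂ} {k : ℕ} (hA : IsSmoothProjective k A.X) (hAs : A.IsSimple) (hA2 : 2 ≤ A.dim) {E : Fin (m + 1) → AbelianVariety ℂ}
    (hE1 : ∀ j, (E j).dim = 1) (hcm : ∀ j, ¬ IsOfCMType (E j)) (hXP : IsIsogenous X (A.prod (⨁ E))) :
    haveI := BettiUniverse.finite hX 1
    haveI := BettiUniverse.finite hA 1
    ∃ a : ℕ, 1 ≤ a ∧ a ≤ m + 1 ∧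
      (BettiUniverse.hodge exists_isReal_hodgeModel_holds hX 1).mtRank = (BettiUniverse.hodge exists_isReal_hodgeModel_holds hA 1).mtRank + 3 * a :=
  exists_mtRank_hodge_one_eq_add_of_isIsogenous_prod_biproduct_nonCM_curves' hX hA (by omega) hE1 hcm
    (fun j u => hom_eq_zero_of_isSimple_of_not_isIsogenous hAs (isSimple_of_dim_le_one (hE1 j).le)
      (fun h => by have hd : A.dim = (E j).dim := dim_eq_of_isIsogenous_holds h; rw [hE1] at hd; omega) u) hXP

/-! ## §2 Simple threefold with totally real `End⁰` times arbitrary curves: `t = t(T) + 3a + b` -/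

/-- **`t(T × E₀ × ⋯ × E_m) = t(T) + 3a + b` for a simple abelian THREEFOLD with `dim_ℚ End⁰T ∈ {1, 3}`** (`End⁰T = ℚ`, `t(T) = 22`, or a totally real
cubic field, `t(T) = 10`) and ARBITRARY elliptic curves: `Hom(⨁ E, T) = 0`, `t(X) + 1 = t(T) + t(⨁ E)` (Moonen–Zarhin (5.2), the gen-47 engines) and
`t(⨁ E) = 3a + b + 1`. [cite: MoonenZarhin1999LowDim, §2 (2.3), §3 (3.4) and §5 (5.2)] [cite: MumfordAV1970, §19 Cor. 2 of Thm. 1] -/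
theorem exists_mtRank_hodge_one_eq_of_isIsogenous_threefold_totallyRealEnd_prod_biproduct_curves {m : ℕ} (hX : IsSmoothProjective n X.X)
    {T : AbelianVariety ℂ} {k : ℕ} (hT : IsSmoothProjective k T.X) (hTs : T.IsSimple) (hT3 : T.dim = 3)
    (hTE : Module.finrank ℚ T.endAlgebra = 1 ∨ Module.finrank ℚ T.endAlgebra = 3) {E : Fin (m + 1) → AbelianVariety ℂ} (hE1 : ∀ j, (E j).dim = 1)
    (hXP : IsIsogenous X (T.prod (⨁ E))) :
    haveI := BettiUniverse.finite hX 1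
    haveI := BettiUniverse.finite hT 1
    ∃ a b : ℕ, 1 ≤ a + b ∧ a + b ≤ m + 1 ∧
      (BettiUniverse.hodge exists_isReal_hodgeModel_holds hX 1).mtRank = (BettiUniverse.hodge exists_isReal_hodgeModel_holds hT 1).mtRank + 3 * a + b ∧
      (a = 0 ↔ ∀ j, IsOfCMType (E j)) ∧ (b = 0 ↔ ∀ j, ¬ IsOfCMType (E j)) := by
  classical
  have hkT : T.dim = k := schemeDim_eq_holds hT
  subst hkT
  have hP := AbelianVariety.isSmoothProjective_holds (A := ⨁ E)
  haveI := BettiUniverse.finite hX 1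
  haveI := BettiUniverse.finite hT 1
  haveI := BettiUniverse.finite hP 1
  have hP0 : 0 < (⨁ E).dim := by
    rw [AndreRiemann.dim_biproduct_fin]
    exact Finset.sum_pos (fun j _ => by rw [hE1]; exact one_pos) Finset.univ_nonempty
  have hPT : ∀ u : (⨁ E) ⟶ T, u = 0 := fun u => biproduct.hom_ext' _ _ fun j => by
    rw [comp_zero]
    exact hom_eq_zero_of_isSimple_of_not_isIsogenous (isSimple_of_dim_le_one (hE1 j).le) hTs
      (fun h => by have hd : (E j).dim = T.dim := dim_eq_of_isIsogenous_holds h; rw [hE1] at hd; omega) _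
  have hXP' : IsIsogenous X ((⨁ E).prod T) := hXP.trans (Literature.AlgebraicGeometry.HodgeTheory.isIsogenous_prod_comm T (⨁ E))
  obtain ⟨a, b, h1, hm, ht, ha, hb⟩ := exists_mtRank_hodge_one_eq_of_biproduct_curves hP hE1 (IsIsogenous.refl _)
  rcases hTE with hT1 | hT3'
  · have h := mtRank_hodge_one_eq_add_of_isIsogenous_prod_threefold_endRankOne hX hP hP0 hT3 hT1 hPT hXP'
    have h22 := (mtRank_hodge_one_eq_twentytwo_of_threefold_of_finrank_endAlgebra_eq_one hT hT3 hT1).1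
    exact ⟨a, b, h1, hm, by omega, ha, hb⟩
  · have h := mtRank_hodge_one_eq_add_nine_of_isIsogenous_prod_threefold_of_finrank_endAlgebra_eq_three hX hP hP0 hTs hT3 hT3' hPT hXP'
    have h10 := (mtRank_hodge_one_of_isSimple_threefold_of_finrank_endAlgebra_eq_three hT hTs hT3 hT3').1
    exact ⟨a, b, h1, hm, by omega, ha, hb⟩

/-- **Fivefold cells `T × E × E'` with `End⁰T = ℚ`: `t ∈ {23, 24, 25, 26, 28}`; with `End⁰T` a cubic totally real field: `t ∈ {11, 12, 13, 14, 16}`**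
(`t(T) − 1 + t(E × E')`, `t(E × E') ∈ {2, 3, 4, 5, 7}`). [cite: MoonenZarhin1999LowDim, §2 (2.3), §3 (3.4) and §5 (5.2)] -/
theorem mtRank_hodge_one_mem_of_isIsogenous_threefold_totallyRealEnd_prod_biproduct_two_curves (hX : IsSmoothProjective n X.X) {T : AbelianVariety ℂ}
    (hTs : T.IsSimple) (hT3 : T.dim = 3) {E : Fin 2 → AbelianVariety ℂ} (hE1 : ∀ j, (E j).dim = 1) (hXP : IsIsogenous X (T.prod (⨁ E))) :
    haveI := BettiUniverse.finite hX 1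
    (Module.finrank ℚ T.endAlgebra = 1 → (BettiUniverse.hodge exists_isReal_hodgeModel_holds hX 1).mtRank ∈ ({23, 24, 25, 26, 28} : Finset ℕ)) ∧
      (Module.finrank ℚ T.endAlgebra = 3 → (BettiUniverse.hodge exists_isReal_hodgeModel_holds hX 1).mtRank ∈ ({11, 12, 13, 14, 16} : Finset ℕ)) := by
  have hT : IsSmoothProjective T.dim T.X := AbelianVariety.isSmoothProjective_holds
  haveI := BettiUniverse.finite hX 1
  haveI := BettiUniverse.finite hT 1
  simp only [Finset.mem_insert, Finset.mem_singleton]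
  refine ⟨fun hT1 => ?_, fun hT3' => ?_⟩
  · obtain ⟨a, b, h1, hm, ht, -, -⟩ :=
      exists_mtRank_hodge_one_eq_of_isIsogenous_threefold_totallyRealEnd_prod_biproduct_curves (m := 1) hX hT hTs hT3 (Or.inl hT1) hE1 hXP
    have h22 := (mtRank_hodge_one_eq_twentytwo_of_threefold_of_finrank_endAlgebra_eq_one hT hT3 hT1).1
    omega
  · obtain ⟨a, b, h1, hm, ht, -, -⟩ :=
      exists_mtRank_hodge_one_eq_of_isIsogenous_threefold_totallyRealEnd_prod_biproduct_curves (m := 1) hX hT hTs hT3 (Or.inr hT3') hE1 hXP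
    have h10 := (mtRank_hodge_one_of_isSimple_threefold_of_finrank_endAlgebra_eq_three hT hTs hT3 hT3').1
    omega

end Summit.HodgeConjecture.CorCM

end
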